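import Summits.Ventures.CertifiedManyBodySolver.Observables.SourcedGibbsTrialCapAFBlock
import Summits.Ventures.CertifiedManyBodySolver.Observables.SourcedGibbsTrialCapAFRiemann
import HarnessLib

/-!
# The AF–BCS sourced cap in momentum space (XV-d): Lipschitz constants of the AF density and moment integrands in
# the band variables `(ε, G)`

Cell hubbard-obs (seat hubbard-obs-pin-2). HONEST FRAMING: zero compute; real-analysis lemmas towards the uniform-in-`L`
packaging of the certified AF–BCS cap `groundEnergy_dWaveSourceTorus_le_AFBCS_kSpace` (`AF-TL-PACKAGING.md`, step 3):
the closed-form density coefficient `c₀₀(ε, G)` and staggered-moment coefficient `c_{Q0}(ε, G)` of that cap are the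
entries `F₀₀`, `F₂₀` of the Fermi functional calculus `F = f_β(H(ε, G))` of the `4 × 4` AF Nambu–Bloch block (file
XV-c), hence — by the Hilbert–Schmidt Lipschitz bound (`Literature/LinearAlgebra/Matrix/HermitianMatrixFunctionLipschitz`,
file XV-a) and `‖H(ε, G) − H(ε', G')‖_HS = 2√((ε−ε')² + (G−G')²)` — Lipschitz in `(ε, G)` with constant `β/2`:
`|c(ε, G) − c(ε', G')| ≤ (β/2)(|ε − ε'| + |G − G'|)` (`β ≥ 0`, `μ' ≠ 0`, `M ≠ 0`). Composing with
`ε = −2(cos x + cos y)`, `G = 2√2h(cos x − cos y)` gives the per-momentum constants `β(1 + √2|h|)` of the Davis–Rabinowitz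
step (successor file). No number is claimed; not a statement about order; not a superconductivity verdict.

* `sum_norm_sq_afBlock_sub` — `Σ‖(H(ε,G) − H(ε',G'))_{ij}‖² = 4(ε−ε')² + 4(G−G')²`;
* `sqrt_sum_norm_sq_afBlock_sub_le` — `… ≤ (2(|ε−ε'| + |G−G'|))²` under the square root;
* `cfc_fermi_afBlock_apply_zero_zero` / `_two_zero` — `F₀₀ = c₀₀(ε,G)`, `F₂₀ = c_{Q0}(ε,G)` (from file XV-c);
* `abs_afDensityCoeff_sub_le`, `abs_afMomentCoeff_sub_le` — the Lipschitz bounds in `(ε, G)`.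

References: Davis–Rabinowitz (1984) §2.1 [DavisRabinowitz1984]; Hirsch PRB 31 (1985) 4403 [HirschPRB1985];
Rosenblum–Rovnyak (1985) Ch. 2 Addenda no. 3 Lemma A [RosenblumRovnyak1985].
-/

noncomputable section

open Real Finset Matrix

namespace Summit.Ventures.CertifiedManyBodySolver.Observables

/-! ### §1 The Hilbert–Schmidt distance between two AF blocks -/

/-- `Σ_{ij} ‖(H(ε,G) − H(ε',G'))_{ij}‖² = 4(ε − ε')² + 4(G − G')²` for the AF Nambu–Bloch block (same `M, μ'`).
[cite: HirschPRB1985] -/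
theorem sum_norm_sq_afBlock_sub (ε G ε' G' M μ' : ℝ) :
    ∑ i, ∑ j, ‖(afBlock ε G M μ' - afBlock ε' G' M μ') i j‖ ^ 2 = 4 * (ε - ε') ^ 2 + 4 * (G - G') ^ 2 := by
  simp only [Fin.sum_univ_four, Matrix.sub_apply, afBlock, Matrix.of_apply, Matrix.cons_val', Matrix.cons_val_zero,
    Matrix.cons_val_one, Matrix.empty_val', Matrix.cons_val_fin_one, Matrix.cons_val_two, Matrix.cons_val_three,
    Matrix.head_cons, Matrix.head_fin_const, Matrix.tail_cons]
  simp only [← Complex.ofReal_sub, Complex.norm_real, Real.norm_eq_abs, sq_abs, sub_zero, norm_zero]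
  ring

/-- `√(Σ‖(H(ε,G) − H(ε',G'))_{ij}‖²) ≤ 2(|ε − ε'| + |G − G'|)`. [cite: HirschPRB1985] -/
theorem sqrt_sum_norm_sq_afBlock_sub_le (ε G ε' G' M μ' : ℝ) :
    Real.sqrt (∑ i, ∑ j, ‖(afBlock ε G M μ' - afBlock ε' G' M μ') i j‖ ^ 2) ≤ 2 * (|ε - ε'| + |G - G'|) := by
  rw [sum_norm_sq_afBlock_sub]
  have h0 : 0 ≤ 2 * (|ε - ε'| + |G - G'|) := by positivity
  refine Real.sqrt_le_iff.2 ⟨h0, ?_⟩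
  nlinarith [sq_abs (ε - ε'), sq_abs (G - G'), abs_nonneg (ε - ε'), abs_nonneg (G - G')]

/-! ### §2 The density and moment coefficients are entries of `f_β(H)` -/

/-- `F₀₀ = c₀₀(ε, G)`: the `(0,0)` entry of `f_β(H(ε,G))` is the closed-form density coefficient (`μ' ≠ 0`, `M ≠ 0`).
[cite: HirschPRB1985] -/
theorem cfc_fermi_afBlock_apply_zero_zero (ε G M μ' β : ℝ) (hμ : μ' ≠ 0) (hM : M ≠ 0) :
    cfc (fun x : ℝ => (1 - Real.tanh (β * x / 2)) / 2) (afBlock ε G M μ') 0 0 = (((1 / 2 - Real.tanh (β * Real.sqrt ((Real.sqrt (ε ^ 2 + M ^ 2) + |μ'|) ^ 2 + G ^ 2) / 2) / (2 * Real.sqrt ((Real.sqrt (ε ^ 2 + M ^ 2) + |μ'|) ^ 2 + G ^ 2)) * ((ε - μ') / 2 - μ' / (2 * |μ'| * Real.sqrt (ε ^ 2 + M ^ 2)) * (ε ^ 2 + M ^ 2 - ε * μ')) - Real.tanh (β * Real.sqrt ((Real.sqrt (ε ^ 2 + M ^ 2) - |μ'|) ^ 2 + G ^ 2) / 2) / (2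 * Real.sqrt ((Real.sqrt (ε ^ 2 + M ^ 2) - |μ'|) ^ 2 + G ^ 2)) * ((ε - μ') / 2 + μ' / (2 * |μ'| * Real.sqrt (ε ^ 2 + M ^ 2)) * (ε ^ 2 + M ^ 2 - ε * μ'))) : ℝ) : ℂ) := by
  have h := congrFun (cfc_fermi_afBlock_mulVec_single_zero_eq ε G M μ' β hμ hM) 0
  rw [Matrix.mulVec_single_one] at h
  simpa using h

/-- `F₂₀ = c_{Q0}(ε, G)`: the `(2,0)` entry of `f_β(H(ε,G))` is the closed-form staggered-moment coefficient
(`μ' ≠ 0`, `M ≠ 0`). [cite: HirschPRB1985] -/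
theorem cfc_fermi_afBlock_apply_two_zero (ε G M μ' β : ℝ) (hμ : μ' ≠ 0) (hM : M ≠ 0) :
    cfc (fun x : ℝ => (1 - Real.tanh (β * x / 2)) / 2) (afBlock ε G M μ') 2 0 = (((-M * (Real.tanh (β * Real.sqrt ((Real.sqrt (ε ^ 2 + M ^ 2) + |μ'|) ^ 2 + G ^ 2) / 2) / (2 * Real.sqrt ((Real.sqrt (ε ^ 2 + M ^ 2) + |μ'|) ^ 2 + G ^ 2)) * (1 / 2 + μ' / (2 * |μ'| * Real.sqrt (ε ^ 2 + M ^ 2)) * μ') + Real.tanh (β * Real.sqrt ((Real.sqrt (ε ^ 2 + M ^ 2) - |μ'|) ^ 2 + G ^ 2) / 2) / (2 * Real.sqrt ((Real.sqrt (ε ^ 2 + M ^ 2) - |μ'|) ^ 2 + G ^ 2)) * (1 / 2 - μ' / (2 * |μ'| * Real.sqrt (ε ^ 2 + M ^ 2)) * μ'))) : ℝ) : ℂ) := by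
  have h := congrFun (cfc_fermi_afBlock_mulVec_single_zero_eq ε G M μ' β hμ hM) 2
  rw [Matrix.mulVec_single_one] at h
  simpa using h

/-! ### §3 Lipschitz bounds in `(ε, G)` -/

/-- **The AF density coefficient is `β/2`-Lipschitz in `(ε, G)`**: for `β ≥ 0`, `μ' ≠ 0`, `M ≠ 0`,
`|c₀₀(ε, G) − c₀₀(ε', G')| ≤ (β/4)·2(|ε − ε'| + |G − G'|)` — Hilbert–Schmidt Lipschitz bound for `f_β` (Lipschitz
constant `β/4`) on the two AF blocks. [cite: DavisRabinowitz1984, §2.1 eq. (2.1.6)] [cite: RosenblumRovnyak1985, Ch. 2 Examples and Addenda no. 3 Lemma A] -/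
theorem abs_afDensityCoeff_sub_le {β : ℝ} (hβ : 0 ≤ β) {μ' M : ℝ} (hμ : μ' ≠ 0) (hM : M ≠ 0) (ε G ε' G' : ℝ) :
    |(1 / 2 - Real.tanh (β * Real.sqrt ((Real.sqrt (ε ^ 2 + M ^ 2) + |μ'|) ^ 2 + G ^ 2) / 2) / (2 * Real.sqrt ((Real.sqrt (ε ^ 2 + M ^ 2) + |μ'|) ^ 2 + G ^ 2)) * ((ε - μ') / 2 - μ' / (2 * |μ'| * Real.sqrt (ε ^ 2 + M ^ 2)) * (ε ^ 2 + M ^ 2 - ε * μ')) - Real.tanh (β * Real.sqrt ((Real.sqrt (ε ^ 2 + M ^ 2) - |μ'|) ^ 2 + G ^ 2) / 2) / (2 * Real.sqrt ((Real.sqrt (ε ^ 2 + M ^ 2) - |μ'|) ^ 2 + G ^ 2)) * ((ε - μ') / 2 + μ' / (2 * |μ'| * Real.sqrt (ε ^ 2 + M ^ 2)) * (ε ^ 2 + M ^ 2 - ε * μ'))) - (1 / 2 - Real.tanh (β * Real.sqrt ((Real.sqrt (ε' ^ 2 + M ^ 2) + |μ'|) ^ 2 + G' ^ 2) / 2) /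 (2 * Real.sqrt ((Real.sqrt (ε' ^ 2 + M ^ 2) + |μ'|) ^ 2 + G' ^ 2)) * ((ε' - μ') / 2 - μ' / (2 * |μ'| * Real.sqrt (ε' ^ 2 + M ^ 2)) * (ε' ^ 2 + M ^ 2 - ε' * μ')) - Real.tanh (β * Real.sqrt ((Real.sqrt (ε' ^ 2 + M ^ 2) - |μ'|) ^ 2 + G' ^ 2) / 2) / (2 * Real.sqrt ((Real.sqrt (ε' ^ 2 + M ^ 2) - |μ'|) ^ 2 + G' ^ 2)) * ((ε' - μ') / 2 + μ' / (2 * |μ'| * Real.sqrt (ε' ^ 2 + M ^ 2)) * (ε' ^ 2 + M ^ 2 - ε' * μ')))| ≤ β / 4 * (2 * (|ε - ε'| + |G - G'|)) := by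
  have h := norm_fermi_cfc_sub_apply_le hβ (afBlock_isHermitian ε G M μ') (afBlock_isHermitian ε' G' M μ') 0 0
  rw [Matrix.sub_apply, cfc_fermi_afBlock_apply_zero_zero ε G M μ' β hμ hM,
    cfc_fermi_afBlock_apply_zero_zero ε' G' M μ' β hμ hM, ← Complex.ofReal_sub, Complex.norm_real, Real.norm_eq_abs] at h
  exact h.trans (mul_le_mul_of_nonneg_left (sqrt_sum_norm_sq_afBlock_sub_le ε G ε' G' M μ') (by positivity))

/-- **The AF staggered-moment coefficient is `β/2`-Lipschitz in `(ε, G)`**: for `β ≥ 0`, `μ' ≠ 0`, `M ≠ 0`,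
`|c_{Q0}(ε, G) − c_{Q0}(ε', G')| ≤ (β/4)·2(|ε − ε'| + |G − G'|)`.
[cite: DavisRabinowitz1984, §2.1 eq. (2.1.6)] [cite: RosenblumRovnyak1985, Ch. 2 Examples and Addenda no. 3 Lemma A] -/
theorem abs_afMomentCoeff_sub_le {β : ℝ} (hβ : 0 ≤ β) {μ' M : ℝ} (hμ : μ' ≠ 0) (hM : M ≠ 0) (ε G ε' G' : ℝ) :
    |(-M * (Real.tanh (β * Real.sqrt ((Real.sqrt (ε ^ 2 + M ^ 2) + |μ'|) ^ 2 + G ^ 2) / 2) / (2 * Real.sqrt ((Real.sqrt (ε ^ 2 + M ^ 2) + |μ'|) ^ 2 + G ^ 2)) * (1 / 2 + μ' / (2 * |μ'| * Real.sqrt (ε ^ 2 + M ^ 2)) * μ') + Real.tanh (β * Real.sqrt ((Real.sqrt (ε ^ 2 + M ^ 2) - |μ'|) ^ 2 + G ^ 2) / 2) / (2 * Real.sqrt ((Real.sqrt (ε ^ 2 + M ^ 2) - |μ'|) ^ 2 + G ^ 2)) * (1 / 2 - μ' / (2 * |μ'| * Real.sqrt (ε ^ 2 + M ^ 2)) * μ')))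 - (-M * (Real.tanh (β * Real.sqrt ((Real.sqrt (ε' ^ 2 + M ^ 2) + |μ'|) ^ 2 + G' ^ 2) / 2) / (2 * Real.sqrt ((Real.sqrt (ε' ^ 2 + M ^ 2) + |μ'|) ^ 2 + G' ^ 2)) * (1 / 2 + μ' / (2 * |μ'| * Real.sqrt (ε' ^ 2 + M ^ 2)) * μ') + Real.tanh (β * Real.sqrt ((Real.sqrt (ε' ^ 2 + M ^ 2) - |μ'|) ^ 2 + G' ^ 2) / 2) / (2 * Real.sqrt ((Real.sqrt (ε' ^ 2 + M ^ 2) - |μ'|) ^ 2 + G' ^ 2)) * (1 / 2 - μ' / (2 * |μ'| * Real.sqrt (ε' ^ 2 + M ^ 2)) * μ')))| ≤ β / 4 * (2 * (|ε - ε'| + |G - G'|)) := by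
  have h := norm_fermi_cfc_sub_apply_le hβ (afBlock_isHermitian ε G M μ') (afBlock_isHermitian ε' G' M μ') 2 0
  rw [Matrix.sub_apply, cfc_fermi_afBlock_apply_two_zero ε G M μ' β hμ hM,
    cfc_fermi_afBlock_apply_two_zero ε' G' M μ' β hμ hM, ← Complex.ofReal_sub, Complex.norm_real, Real.norm_eq_abs] at h
  exact h.trans (mul_le_mul_of_nonneg_left (sqrt_sum_norm_sq_afBlock_sub_le ε G ε' G' M μ') (by positivity))

end Summit.Ventures.CertifiedManyBodySolver.Observables
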